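import Summits.CriticalPhenomena.PercolationContinuityZ3.Theorems.PercNearOneGluingNoHeavyLowerTailSahiOrCylinders
import Summits.CriticalPhenomena.PercolationContinuityZ3.Theorems.PercNearOneGluingNoHeavyLowerTailSahiAllButOneEvent

/-!
# `NoHeavyLowerTail` (crux stmt-CriticalPhenomena-4575), Sahi / Kahn positivity: the OR OF TWO DISJOINT CYLINDERS slot (II) — event forms

Support file (cell `prim-l12`, seat P3, gen 8; `--supports stmt-CriticalPhenomena-4575`).  No `sorry`, no named facts, standard axioms.
New mathematics (this programme).

The event forms of `…SahiOrCylinders.sahiE_three_nonneg_of_orCyl`.  For a block `e : Fin k ↪ ι` (`k ≥ 1`) and `S ⊆ Fin k` put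
`A = e '' S`, `B = e '' Sᶜ` and `H = {ω : A ⊆ ω} ∪ {ω : B ⊆ ω}` ("all of `A` open or all of `B` open").  Then for all increasing `U, V`:
* `sahiE_three_orCylEvent_nonneg`: `E₃(1_H, 1_U, 1_V) ≥ 0` when the parameters are interior on the block;
* **`sahiE_three_orCylEvent_nonneg'`: `E₃(1_H, 1_U, 1_V) ≥ 0` for EVERY `p : ι → [0,1]`** (closure argument
  `…SahiAllButOneEvent.sahiE_nonneg_of_interior`);
* `sahiE_three_orCylinders_nonneg`: the same for two arbitrary DISJOINT finite sets `A, B ⊆ ι`, not both empty — Kahn's Conjecture 5 /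
  Sahi's `C₃` for every first slot of the form `{A ⊆ ω} ∪ {B ⊆ ω}`, `A ∩ B = ∅`, every `p`, every dimension. [this work]
-/

noncomputable section

open scoped Classical

namespace Summit.CriticalPhenomena.PercolationContinuityZ3.Theorems

namespace SahiOrCylinders

open Finset
open SahiHittingSlot SahiTransportCert
open Literature.Combinatorics.Sahi2008
open Literature.Probability.Percolation (DeterminedBy determinedBy_iff)
open Literature.Probability.Percolation.DecisionTree (ind ind_of_mem ind_of_not_mem ind_nonneg)

variable {ι : Type} {k : ℕ}

/-- The OR-of-two-cylinders event of a pair of sets of coordinates. [this work] -/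
def orCylEvent (A B : Set ι) : Set (Set ι) := {ω | A ⊆ ω} ∪ {ω | B ⊆ ω}

/-- It is increasing. [this work] -/
theorem isUpperSet_orCylEvent (A B : Set ι) : IsUpperSet (orCylEvent A B) :=
  IsUpperSet.union (fun _ _ hle hω => Set.Subset.trans hω hle) (fun _ _ hle hω => Set.Subset.trans hω hle)

/-- A cylinder over a subset of the block is determined by the block. [folklore] -/
theorem determinedBy_cyl_of_subset {A W : Set ι} (hAW : A ⊆ W) : DeterminedBy {ω : Set ι | A ⊆ ω} W := by
  rw [determinedBy_iff]
  intro ω ω' h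
  simp only [Set.mem_setOf_eq]
  constructor
  · intro hA a ha; have : a ∈ ω ∩ W := ⟨hA ha, hAW ha⟩; rw [h] at this; exact this.1
  · intro hA a ha; have : a ∈ ω' ∩ W := ⟨hA ha, hAW ha⟩; rw [← h] at this; exact this.1

/-- The OR event of `e '' S`, `e '' Sᶜ` is determined by the block. [this work] -/
theorem determinedBy_orCylEvent (e : Fin k ↪ ι) (S : Set (Fin k)) :
    DeterminedBy (orCylEvent (e '' S) (e '' Sᶜ)) (Set.range e) := by
  have hA := determinedBy_cyl_of_subset (Set.image_subset_range e S)
  have hB := determinedBy_cyl_of_subset (Set.image_subset_range e Sᶜ)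
  rw [determinedBy_iff] at hA hB ⊢
  intro ω ω' h
  simp only [orCylEvent, Set.mem_union]
  rw [hA ω ω' h, hB ω ω' h]

/-- Its pattern event is `orCyl S`. [this work] -/
theorem pat_orCylEvent (e : Fin k ↪ ι) (S : Set (Fin k)) : pat e (orCylEvent (e '' S) (e '' Sᶜ)) = orCyl S := by
  ext T
  simp only [pat, orCylEvent, orCyl, Set.mem_setOf_eq, Set.mem_union, Set.image_subset_image_iff e.injective]

/-- **The OR-of-two-disjoint-cylinders slot theorem, event form** (interior parameters on the block). [this work] -/
theorem sahiE_three_orCylEvent_nonneg [Fintype ι] (p : ι → unitInterval) (e : Fin k ↪ ι) (hk : 0 < k) (S : Set (Fin k))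
    (hp : ∀ i, 0 < (p (e i) : ℝ) ∧ (p (e i) : ℝ) < 1) {U V : Set (Set ι)} (hU : IsUpperSet U) (hV : IsUpperSet V) :
    0 ≤ sahiE (bernoulliWeight p) 3 ![ind (orCylEvent (e '' S) (e '' Sᶜ)), ind U, ind V] :=
  sahiE_three_nonneg_of_orCyl p e hk hp (determinedBy_orCylEvent e S) S (pat_orCylEvent e S) hU hV

/-- **THE OR-OF-TWO-DISJOINT-CYLINDERS SLOT THEOREM FOR ALL PARAMETERS.**  For every block `e : Fin k ↪ ι` (`k ≥ 1`), every `S ⊆ Fin k`,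
every `p : ι → [0,1]` and all increasing `U, V`: `E₃(1_{{e''S ⊆ ω} ∪ {e''Sᶜ ⊆ ω}}, 1_U, 1_V) ≥ 0`. [this work] -/
theorem sahiE_three_orCylEvent_nonneg' [Fintype ι] (p : ι → unitInterval) (e : Fin k ↪ ι) (hk : 0 < k) (S : Set (Fin k))
    {U V : Set (Set ι)} (hU : IsUpperSet U) (hV : IsUpperSet V) :
    0 ≤ sahiE (bernoulliWeight p) 3 ![ind (orCylEvent (e '' S) (e '' Sᶜ)), ind U, ind V] :=
  SahiAllButOne.sahiE_nonneg_of_interior (Set.range e) _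
    (fun p' hp' => sahiE_three_orCylEvent_nonneg p' e hk S (fun i => hp' (e i) ⟨i, rfl⟩) hU hV) p

/-- **KAHN'S CONJECTURE 5 / SAHI'S `C₃` FOR THE FIRST SLOT `{A ⊆ ω} ∪ {B ⊆ ω}`, `A, B` DISJOINT FINITE SETS OF COORDINATES (not both
empty), every `p`, all increasing `U, V`, every dimension.** [this work] -/
theorem sahiE_three_orCylinders_nonneg [Fintype ι] (p : ι → unitInterval) {A B : Finset ι} (hAB : Disjoint A B)
    (hne : (A ∪ B).Nonempty) {U V : Set (Set ι)} (hU : IsUpperSet U) (hV : IsUpperSet V) :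
    0 ≤ sahiE (bernoulliWeight p) 3 ![ind (orCylEvent (↑A : Set ι) ↑B), ind U, ind V] := by
  -- enumerate the block `A ∪ B`
  set k := (A ∪ B).card with hk
  let f : Fin k ≃ ↥(A ∪ B) := (Finset.equivFinOfCardEq rfl).symm
  let e : Fin k ↪ ι := ⟨fun i => (f i : ι), fun i j h => f.injective (Subtype.ext h)⟩
  have hkpos : 0 < k := Finset.card_pos.2 hne
  have hrange : Set.range e = ↑(A ∪ B) := by
    ext x
    constructor
    · rintro ⟨i, rfl⟩; exact (f i).2
    · intro hx; exact ⟨f.symm ⟨x, hx⟩, by simp [e]⟩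
  -- `S = e⁻¹(A)`; then `e '' S = A` and `e '' Sᶜ = B`
  set S : Set (Fin k) := {i | (e i : ι) ∈ A} with hS
  have hA : e '' S = ↑A := by
    ext x
    constructor
    · rintro ⟨i, hi, rfl⟩; exact hi
    · intro hx
      have hx' : x ∈ Set.range e := by rw [hrange]; exact Finset.mem_union_left B hx
      obtain ⟨i, rfl⟩ := hx'
      exact ⟨i, hx, rfl⟩
  have hB : e '' Sᶜ = ↑B := by
    ext x
    constructor
    · rintro ⟨i, hi, rfl⟩
      have hx : (e i : ι) ∈ A ∪ B := by rw [← Finset.mem_coe, ← hrange]; exact ⟨i, rfl⟩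
      rcases Finset.mem_union.1 hx with h | h
      · exact (hi h).elim
      · exact h
    · intro hx
      have hx' : x ∈ Set.range e := by rw [hrange]; exact Finset.mem_union_right A hx
      obtain ⟨i, rfl⟩ := hx'
      exact ⟨i, fun h => Finset.disjoint_left.1 hAB h hx, rfl⟩
  have h := sahiE_three_orCylEvent_nonneg' p e hkpos S hU hV
  rwa [hA, hB] at h

end SahiOrCylinders

end Summit.CriticalPhenomena.PercolationContinuityZ3.Theorems
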